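import Summits.BirchSwinnertonDyer.BirchSwinnertonDyer.Theorems.GenusKolyvaginAtTwoOffCutResidualAtTwoRSocleSelectionTwistSelmerPair
import Summits.BirchSwinnertonDyer.BirchSwinnertonDyer.Theorems.GenusKolyvaginAtTwoGenusPrimitiveSupplyAtTwoPrimeTwistUnramifiedTwo
import Summits.BirchSwinnertonDyer.BirchSwinnertonDyer.Theorems.GenusKolyvaginAtTwoGenusPrimitiveSupplyAtTwoTranspositionTwistLaw
import Summits.BirchSwinnertonDyer.BirchSwinnertonDyer.Theorems.ByReductionTypeAtTwoRankOneAtTwoBigImageOddLocalOneDoorBottomLeavesLines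
import Summits.BirchSwinnertonDyer.BirchSwinnertonDyer.Theorems.GenusKolyvaginAtTwoEquivariantKolyvaginExactAtTwoPairBookkeeping
import HarnessLib

/-!
# Route `GenusKolyvaginAtTwo`, residual `OffCutResidualAtTwoR` (stmt-BirchSwinnertonDyer-31767), LINE 28 «visible_deep_socle» STUB N2 —
# the `Δ < 0` TWIN of LINE 27's socle identification: on a TRANSPOSITION-admissible prime frame the `ℓ₀`-TRIVIAL line of `Sel₂(E)`
# IS the twin's Selmer group `Sel_𝔓(A_χ) = {0, s_y}`; `ℓ₀`-narrowness is automatic; N2's (LTV)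

LEAD seat `bsd-line-gk2-p1` g25 (cell `bsd-f1-sign2`), `--supports stmt-BirchSwinnertonDyer-31767 --as helper`; sequel of p776743 / p777033 (the real place `∞` of LINE 27
replaced by the door place `v₀ ∣ ℓ₀` of LINE 28).  THEOREMS ONLY (no definition, no named fact, no `sorry`).  **BSD is NOT proved by this file; `OffCutResidualAtTwoR`,
K4Neg and crux 23491 are NOT proved; N2 is NOT closed (its (HL) conjunct and the frame supplier «deep prime frame ⟹ `TranspAdmissible`» remain).**

THE FRAME.  `E/ℚ` globally minimal with `Δ_E < 0`, `ρ̄_{E,2}` onto (so `E(ℚ)[2] = 0`), `#Sel₂(E) = 4`; `(d, q₀)` TRANSPOSITION-ADMISSIBLE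
(`F1Sign2.TranspositionDoor.TranspAdmissible E d q₀`: `d < 0` squarefree, `d ≡ 1 (8)`, `q₀ ∣ d` with `(Δ/q₀) = −1` — ONE root of the `2`-division cubic —,
the other primes of `d` silent, the odd bad primes split), `v₀ ∋ q₀`; `Wd = Cd • E^{(d)}` with `#Sel₂(Wd) = 2`; `χ = χ_d`; `T := Sel_𝔓(A_χ/ℚ) ⊆ H¹(ℚ, E[2])`.

* §1 `primeTwist_selmerLocalKer_adicCompletion_eq_of_transpAdmissible_of_ne` — THE ONE-PLACE DICTIONARY OFF THE DOOR: at every finite `v ≠ v₀`,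
  `H¹_𝒜(ℚ_v, E[2]) = H¹_f(ℚ_v, E[2])` (gk2-p5's three bricks on gk2-p4's transposition place menu, re-read for `PrimeTwist`).
* §2 **`doorTrivial_iff_mem_primeTwist_selmerGroup`** — for `Δ_E < 0`: a class is a `2`-Selmer class of `E` TRIVIAL AT `v₀` iff it lies in `T`.  (→): §1 off
  `v₀`; at `v₀` a class with `res_{v₀} = 0` satisfies every restriction-kernel condition; at `∞` every Selmer class is trivial for `Δ < 0`
  (`localization_inl_eq_zero_of_mem_selmerGroupRelaxedAtInfinityAtTwo_of_Δ_neg`).  (←): COUNTING — `#T = #Sel₂(Wd) = 2`, and the `v₀`-trivial line has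
  at least two elements because `E`'s Kummer image at the transposition prime is a LINE (`RankOneAtTwoOneDoor.line_inl_of_card`, `#E(ℚ_{v₀})[2] = 2`).
* §3 `natCard_doorTrivial_eq_two`, **`exists_localization_ne_zero_door`** (`ℓ₀`-NARROWNESS IS AUTOMATIC) and **`exists_doorTrivial_ne_zero`** (= N2's (LTV)
  in shape: a non-zero `2`-Selmer class trivial at `v₀`); with p777033 the non-zero element of `T` is the CAPITULATING class `s_y` (`res_K s_y = κ₂(Q₀)`),
  so N2's (SOC) follows exactly as LINE 27's (sequel).
BSD is NOT proved by any of this.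

References: [MazurRubin2010] Lemma 2.2, Lemma 2.10, Prop. 3.3; [MazurRubin2007] §3, Prop 4.1, Def 4.3, §5; [Kramer1981] Prop. 3, Thm. 1; [GrossLMS1991] §5 (5.1).
-/

set_option autoImplicit false
-- the Theorems namespace of this sub repeats the summit name by design (D-0017 nested layout)
set_option linter.dupNamespace false

noncomputable section

open scoped Classical

namespace Summit.BirchSwinnertonDyer.BirchSwinnertonDyer.Theorems.GenusExact.PlusDescent.SocleSelection

open WeierstrassCurve NumberField IsDedekindDomain Field
open Literature.NumberTheory.EllipticCurves Literature.NumberTheory.GaloisRepresentations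
open Literature.NumberTheory.GaloisRepresentations.IsNonarchimedeanLocalField (maxUnramified)
open Summit.BirchSwinnertonDyer.Rank1Residual.F1Sign2 (NoRationalTwoTorsion IsQuadraticCharacterOf
  selmerGroupRelaxedAtInfinityAtTwo selmerGroup_le_selmerGroupRelaxedAtInfinityAtTwo)
open Summit.BirchSwinnertonDyer.Rank1Residual.F1Sign2.TranspositionDoor (TranspAdmissible)
open Summit.BirchSwinnertonDyer.BirchSwinnertonDyer.Theorems.GenusKolyArch
open Summit.BirchSwinnertonDyer.BirchSwinnertonDyer.Theorems.GenusKolyTwistLocal (natCard_ker_nsmul_adicCompletion_eq_padic mem_torsionLocalKer_iff_localization_eq_zero_rat)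
open Summit.BirchSwinnertonDyer.BirchSwinnertonDyer.Theorems.RankOneAtTwoOneDoor (line_inl_of_card natCard_ker_nsmul_adicCompletion_two_eq_two_of_jacobiSym)
open Rat.HeightOneSpectrum (primesEquiv natGenerator)

variable (W : WeierstrassCurve ℚ) [W.IsElliptic] [W.IsGloballyMinimal] {d : ℤ} {q₀ : ℕ}
  {χ : absoluteGaloisGroup ℚ →ₜ* Multiplicative (ZMod 2)}

/-! ## §1 The one-place dictionary off the door prime -/

/-- **`H¹_𝒜(ℚ_v, E[2]) = H¹_f(ℚ_v, E[2])` at every finite `v ≠ v₀`** for a transposition-admissible `(d, q₀)`, `v₀ ∋ q₀`: over `2` (`d ≡ 1 (8)`), over an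
odd bad prime (`(d/ℓ) = 1`) and over a good prime with a local `√d` — the split brick; over a prime `q ≠ q₀` of `d` (`a_q` odd, `W(ℚ_q)[2] = 0`) — the
no-torsion brick; over a good odd prime without local `√d` (`ι√d ∈ ℚ_v^{nr}` as `v ∤ 2d`) — the inert brick.  BSD is NOT proved by this.
[cite: MazurRubin2010, Lemma 2.10] [cite: MazurRubin2007, Def 4.3, Cor 4.6, §5] [cite: Kramer1981, Prop. 3] -/
theorem primeTwist_selmerLocalKer_adicCompletion_eq_of_transpAdmissible_of_ne (hd : TranspAdmissible W d q₀)
    {v₀ : HeightOneSpectrum (𝓞 ℚ)} (hv₀ : (q₀ : 𝓞 ℚ) ∈ v₀.asIdeal) (hχ : IsQuadraticCharacterOf χ d)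
    (v : HeightOneSpectrum (𝓞 ℚ)) (hv : v ≠ v₀) :
    PrimeTwist.selmerLocalKer W χ (v.adicCompletion ℚ) = W.selmerLocalKer (v.adicCompletion ℚ) 2 := by
  obtain ⟨-, -, hd8, hq₀P, -, -, hprimes, hbad⟩ := hd
  haveI := Fact.mk (primesEquiv v).2
  have hpP : (primesEquiv v : ℕ).Prime := (primesEquiv v).2
  have hpv : ((primesEquiv v : ℕ) : 𝓞 ℚ) ∈ v.asIdeal := Rat.HeightOneSpectrum.natCast_natGenerator_mem v
  -- a `p`-adic square gives the split brick
  have hsplit : IsSquare ((d : ℤ) : ℚ_[(primesEquiv v : ℕ)]) →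
      PrimeTwist.selmerLocalKer W χ (v.adicCompletion ℚ) = W.selmerLocalKer (v.adicCompletion ℚ) 2 := fun hsq ↦ by
    have hsq' : IsSquare (((d : ℚ) : ℚ) : ℚ_[(primesEquiv v : ℕ)]) := by
      simpa only [Rat.cast_intCast] using hsq
    obtain ⟨s, hs⟩ := TwoDescentLocal.isSquare_algebraMap_adicCompletion_of_padic v hsq'
    exact primeTwist_selmerLocalKer_adicCompletion_eq_of_exists_sq W hχ v ⟨s, by rw [sq]; exact hs.symm⟩
  by_cases hp2 : (primesEquiv v : ℕ) = 2
  · exact hsplit (Literature.NumberTheory.QuadraticForms.padic_isSquare_intCast_of_mod_eight hp2 hd8)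
  have h2v : ((2 : ℕ) : 𝓞 ℚ) ∉ v.asIdeal :=
    GenusKolyTwistingPrime.natCast_not_mem_of_not_dvd hpP hpv fun h ↦
      hp2 ((Nat.prime_dvd_prime_iff_eq hpP Nat.prime_two).mp h)
  by_cases hpd : ((primesEquiv v : ℕ) : ℤ) ∣ d
  · -- over a prime of `d` other than `q₀`: silent
    have hne : (primesEquiv v : ℕ) ≠ q₀ := by
      intro h
      apply hv
      have hq₀v : ((q₀ : ℕ) : 𝓞 ℚ) ∈ v.asIdeal := by rw [← h]; exact hpv
      exact HeightOneSpectrum.eq_of_natCast_mem_rat hq₀P hq₀v hv₀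
    obtain ⟨hgood, hodd⟩ := hprimes _ hpP hpd
    have hgood' : W.HasGoodReductionAtPrime (primesEquiv v : ℕ) := hgood inferInstance
    have hpΔ : ¬ ((primesEquiv v : ℕ) : ℤ) ∣ minimalDiscriminantInt W :=
      W.not_dvd_minimalDiscriminantInt_of_hasGoodReductionAtPrime' _ hgood'
    have hsil := (GenusKolyTwin.silent_iff_odd_frobeniusTrace W hp2 hpΔ).mpr (hodd hne)
    have hker : Nat.card (nsmulAddMonoidHom 2 : (W.baseChange (v.adicCompletion ℚ)).toAffine.Point →+ _).ker = 1 := by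
      rw [GenusKolyTwistLocal.natCard_ker_nsmul_adicCompletion_eq_padic W v 2]
      have h0 := GenusKolyTwin.twoTorsion_padic_eq_zero_of_forall_ne W hp2 hpΔ hsil
      rw [Nat.card_eq_one_iff_unique]
      refine ⟨⟨fun a b ↦ Subtype.ext ((h0 a.1 a.2).trans (h0 b.1 b.2).symm)⟩, ⟨⟨0, by simp⟩⟩⟩
    exact primeTwist_selmerLocalKer_adicCompletion_eq_of_natCard_ker_eq_one W χ v h2v hker
  by_cases hpN : (primesEquiv v : ℕ) ∣ W.conductorNorm ℤ
  · -- over an odd bad prime: `(d/p) = 1`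
    have hnotgood : ∀ _h : Fact (primesEquiv v : ℕ).Prime, ¬ W.HasGoodReductionAtPrime (primesEquiv v : ℕ) := fun _ hg ↦
      not_dvd_conductorNorm_of_hasGoodReductionAtPrime W hg hpN
    exact hsplit (padic_isSquare_of_jacobiSym_eq_one hp2 (hbad _ hpP hp2 hnotgood))
  · -- over an odd good prime not dividing `d`: split or inert
    have hW : W.HasGoodReductionAt v := by
      by_contra h
      exact hpN ((W.dvd_conductorNorm_iff v).mpr h)
    by_cases hsq : ∃ s : v.adicCompletion ℚ, s ^ 2 = algebraMap ℚ (v.adicCompletion ℚ) (d : ℚ)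
    · exact primeTwist_selmerLocalKer_adicCompletion_eq_of_exists_sq W hχ v hsq
    · push Not at hsq
      exact primeTwist_selmerLocalKer_eq_of_inert W v χ hW (closureEmb_geomSqrt_mem_maxUnramified_of_not_dvd v h2v hpd) hsq
        (localChar_eq_one_iff_of_isQuadraticCharacterOf hχ)

/-! ## §2 The `v₀`-trivial line of `Sel₂(E)` is the twin's Selmer group -/

/-- **(→) A `2`-Selmer class of `E` trivial at the door place lies in `Sel_𝔓(A_χ/ℚ)`** (`Δ_E < 0`, `(d, q₀)` transposition-admissible): off `v₀` by §1, at `v₀`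
because `res_{v₀} = 0` kills every restriction-kernel condition, at `∞` because `Δ < 0` makes every Selmer class trivial there.  BSD is NOT proved by this.
[cite: MazurRubin2010, Lemma 2.10, Lemma 3.2] [cite: MazurRubin2007, Def 4.3] -/
theorem mem_primeTwist_selmerGroup_of_doorTrivial (hΔ : W.Δ < 0) (hd : TranspAdmissible W d q₀)
    {v₀ : HeightOneSpectrum (𝓞 ℚ)} (hv₀ : (q₀ : 𝓞 ℚ) ∈ v₀.asIdeal) (hχ : IsQuadraticCharacterOf χ d)
    {s : galH1Torsion W ((2 : ℕ) : ℤ)} (hs : s ∈ W.selmerGroup ((2 : ℕ) : ℤ))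
    (hs0 : s ∈ W.torsionLocalKer (v₀.adicCompletion ℚ) ((2 : ℕ) : ℤ)) : s ∈ PrimeTwist.selmerGroup W χ := by
  rw [PrimeTwist.mem_selmerGroup_iff]
  have hs' := (mem_selmerGroup_iff W _ s).mp hs
  refine ⟨fun v ↦ ?_, fun w ↦ ?_⟩
  · by_cases hv : v = v₀
    · subst hv
      have h0 : galoisCohomology.localization (W.torsionGaloisModule ((2 : ℕ) : ℤ)) (Sum.inr v) 1 s = 0 :=
        (GenusKolyTwistLocal.mem_torsionLocalKer_iff_localization_eq_zero_rat W v s).mp hs0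
      exact PrimeTwist.mem_selmerLocalKer_of_res_eq_zero W χ (v.adicCompletion ℚ) h0
    · rw [primeTwist_selmerLocalKer_adicCompletion_eq_of_transpAdmissible_of_ne W hd hv₀ hχ v hv]
      exact hs'.1 v
  · have h0 := localization_inl_eq_zero_of_mem_selmerGroupRelaxedAtInfinityAtTwo_of_Δ_neg W hΔ w
      (selmerGroup_le_selmerGroupRelaxedAtInfinityAtTwo W hs)
    exact PrimeTwist.mem_selmerLocalKer_of_res_eq_zero W χ w.Completion h0

/-- **THE `v₀`-TRIVIAL LINE IS THE TWIN'S SELMER GROUP** (`Δ_E < 0`, `#Sel₂(E) = 4`, `(d, q₀)` transposition-admissible, `Wd = Cd • E^{(d)}` with `#Sel₂(Wd) = 2`): `s ∈ Sel₂(E) ∧ res_{v₀} s = 0 ↔ s ∈ Sel_𝔓(A_χ/ℚ)`.  (←) by counting: the `v₀`-trivial Selmer classes form a subgroup of `T` with at least two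
elements — among the three non-zero classes of `Sel₂(E)` two non-`v₀`-trivial ones differ by a `v₀`-trivial one, `E`'s Kummer image at the transposition
prime being a LINE (`#E(ℚ_{v₀})[2] = 2`) — and `#T = #Sel₂(Wd) = 2`.  BSD is NOT proved by this.
[cite: MazurRubin2010, Lemma 2.2, Prop 3.3] [cite: Kramer1981, Prop. 3, Thm. 1] [cite: MazurRubin2007, §3, Prop 4.1, Def 4.3] -/
theorem doorTrivial_iff_mem_primeTwist_selmerGroup (hΔ : W.Δ < 0) (h4 : Nat.card (W.selmerGroup 2) = 4)
    (hd : TranspAdmissible W d q₀) {v₀ : HeightOneSpectrum (𝓞 ℚ)} (hv₀ : (q₀ : 𝓞 ℚ) ∈ v₀.asIdeal)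
    {Wd : WeierstrassCurve ℚ} [Wd.IsElliptic] (Cd : VariableChange ℚ) (hCd : Cd • W.quadraticTwist (d : ℚ) = Wd)
    (hSel : Nat.card (Wd.selmerGroup 2) = 2) (hχ : IsQuadraticCharacterOf χ d) (s : galH1Torsion W ((2 : ℕ) : ℤ)) :
    (s ∈ W.selmerGroup ((2 : ℕ) : ℤ) ∧ s ∈ W.torsionLocalKer (v₀.adicCompletion ℚ) ((2 : ℕ) : ℤ)) ↔ s ∈ PrimeTwist.selmerGroup W χ := by
  refine ⟨fun h ↦ mem_primeTwist_selmerGroup_of_doorTrivial W hΔ hd hv₀ hχ h.1 h.2, fun hsT ↦ ?_⟩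
  obtain ⟨hdneg, hsqf, hd8, hq₀P, hq₀d, hjac, hprimes, hbad⟩ := hd
  haveI : Fact q₀.Prime := ⟨hq₀P⟩
  have hd0 : d ≠ 0 := hdneg.ne
  -- `#T = 2`
  have hcard : Nat.card (PrimeTwist.selmerGroup W χ) = 2 := by
    rw [natCard_primeTwist_selmerGroup_eq_natCard_selmerGroup_rat W hd0 hχ hCd]; exact_mod_cast hSel
  -- a non-zero `v₀`-trivial Selmer class `u`
  have hq₀2 : q₀ ≠ 2 := by
    rintro rfl
    have h2d : (2 : ℤ) ∣ d := by exact_mod_cast hq₀d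
    omega
  have hgood : W.HasGoodReductionAtPrime q₀ := (hprimes q₀ hq₀P hq₀d).1 inferInstance
  have hqΔ : ¬ (q₀ : ℤ) ∣ W.Δ.num := by
    have hnum : W.Δ.num = minimalDiscriminantInt W := by rw [← cast_minimalDiscriminantInt W, Rat.num_intCast]
    rw [hnum]; exact W.not_dvd_minimalDiscriminantInt_of_hasGoodReductionAtPrime' _ hgood
  have hker := natCard_ker_nsmul_adicCompletion_two_eq_two_of_jacobiSym W hq₀2 hgood hqΔ hjac hv₀
  have hline := line_inl_of_card W hq₀2 hv₀ hker
  have h4' : Nat.card (W.selmerGroup ((2 : ℕ) : ℤ)) = 4 := h4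
  set S : AddSubgroup (galH1Torsion W ((2 : ℕ) : ℤ)) := W.selmerGroup ((2 : ℕ) : ℤ) with hSdef
  have hloc : ∀ {x : galH1Torsion W ((2 : ℕ) : ℤ)}, x ∈ S → x ∈ selmerLocalKer W (v₀.adicCompletion ℚ) ((2 : ℕ) : ℤ) :=
    fun hx ↦ ((mem_selmerGroup_iff W _ _).mp hx).1 v₀
  have hu : ∃ u ∈ S, u ≠ 0 ∧ u ∈ W.torsionLocalKer (v₀.adicCompletion ℚ) ((2 : ℕ) : ℤ) := by
    by_contra hno
    push Not at hno
    haveI : Finite S := Nat.finite_of_card_ne_zero (by rw [h4']; norm_num)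
    haveI : Fintype S := Fintype.ofFinite S
    have h3 : 2 < Fintype.card S := by rw [← Nat.card_eq_fintype_card, h4']; norm_num
    obtain ⟨a, b, c, hab, hac, hbc⟩ := (Fintype.two_lt_card_iff).mp h3
    obtain ⟨x, y, hx0, hy0, hxy⟩ : ∃ x y : S, x ≠ 0 ∧ y ≠ 0 ∧ x ≠ y := by
      by_cases ha : a = 0
      · refine ⟨b, c, ?_, ?_, hbc⟩
        · rintro rfl; exact hab ha
        · rintro rfl; exact hac ha
      · by_cases hb : b = 0
        · refine ⟨a, c, ha, ?_, hac⟩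
          rintro rfl; exact hbc hb
        · exact ⟨a, b, ha, hb, hab⟩
    have hx0' : (x : galH1Torsion W ((2 : ℕ) : ℤ)) ≠ 0 := fun h ↦ hx0 (Subtype.ext h)
    have hy0' : (y : galH1Torsion W ((2 : ℕ) : ℤ)) ≠ 0 := fun h ↦ hy0 (Subtype.ext h)
    have hxt := hno x x.2 hx0'
    have hyt := hno y y.2 hy0'
    have hsub := hline x y (hloc x.2) (hloc y.2) hxt hyt
    have hmem : (x : galH1Torsion W ((2 : ℕ) : ℤ)) - y ∈ S := S.sub_mem x.2 y.2
    have hne : (x : galH1Torsion W ((2 : ℕ) : ℤ)) - y ≠ 0 := fun h ↦ hxy (Subtype.ext (sub_eq_zero.mp h))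
    exact hno _ hmem hne hsub
  obtain ⟨u, huS, hu0, hut⟩ := hu
  have huT : u ∈ PrimeTwist.selmerGroup W χ :=
    mem_primeTwist_selmerGroup_of_doorTrivial W hΔ ⟨hdneg, hsqf, hd8, hq₀P, hq₀d, hjac, hprimes, hbad⟩ hv₀ hχ huS hut
  -- `T` has exactly one non-zero element: `s = 0` or `s = u`
  by_cases hs0 : s = 0
  · subst hs0; exact ⟨AddSubgroup.zero_mem _, AddSubgroup.zero_mem _⟩
  obtain ⟨t, ht, huniq⟩ := (Nat.card_eq_two_iff' (⟨0, AddSubgroup.zero_mem _⟩ : PrimeTwist.selmerGroup W χ)).mp hcard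
  have hs_eq : (⟨s, hsT⟩ : PrimeTwist.selmerGroup W χ) = t := huniq _ (fun h ↦ hs0 (congrArg Subtype.val h))
  have hu_eq : (⟨u, huT⟩ : PrimeTwist.selmerGroup W χ) = t := huniq _ (fun h ↦ hu0 (congrArg Subtype.val h))
  have hsu : s = u := by
    have := hs_eq.trans hu_eq.symm
    exact congrArg Subtype.val this
  rw [hsu]
  exact ⟨huS, hut⟩

/-! ## §3 Counted; `ℓ₀`-narrowness is automatic; N2's (LTV) -/

/-- **The `v₀`-trivial `2`-Selmer classes of `E` are exactly TWO** on the transposition-admissible frame (`Δ_E < 0`).  BSD is NOT proved by this.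
[cite: MazurRubin2010, Lemma 2.2, Prop 3.3] [cite: Kramer1981, Thm. 1] -/
theorem natCard_doorTrivial_eq_two (hΔ : W.Δ < 0) (h4 : Nat.card (W.selmerGroup 2) = 4)
    (hd : TranspAdmissible W d q₀) {v₀ : HeightOneSpectrum (𝓞 ℚ)} (hv₀ : (q₀ : 𝓞 ℚ) ∈ v₀.asIdeal)
    {Wd : WeierstrassCurve ℚ} [Wd.IsElliptic] (Cd : VariableChange ℚ) (hCd : Cd • W.quadraticTwist (d : ℚ) = Wd)
    (hSel : Nat.card (Wd.selmerGroup 2) = 2) :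
    Nat.card {s : galH1Torsion W ((2 : ℕ) : ℤ) //
        s ∈ W.selmerGroup ((2 : ℕ) : ℤ) ∧ s ∈ W.torsionLocalKer (v₀.adicCompletion ℚ) ((2 : ℕ) : ℤ)} = 2 := by
  obtain ⟨χ, hχ⟩ := GenusKolyTransp.quadraticCharacterExists_holds d
  have hiff := doorTrivial_iff_mem_primeTwist_selmerGroup W hΔ h4 hd hv₀ Cd hCd hSel hχ
  rw [Nat.card_congr (Equiv.subtypeEquivRight hiff)]
  change Nat.card (PrimeTwist.selmerGroup W χ) = 2
  rw [natCard_primeTwist_selmerGroup_eq_natCard_selmerGroup_rat W hd.1.ne hχ hCd]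
  exact_mod_cast hSel

/-- **N2's (LTV) in shape: a NON-ZERO `2`-Selmer class of `E` trivial at the door place EXISTS** on the transposition-admissible frame (`Δ_E < 0`).
BSD is NOT proved by this. [cite: MazurRubin2010, Lemma 2.2] [cite: Kramer1981, Prop. 3] -/
theorem exists_doorTrivial_ne_zero (hΔ : W.Δ < 0) (h4 : Nat.card (W.selmerGroup 2) = 4)
    (hd : TranspAdmissible W d q₀) {v₀ : HeightOneSpectrum (𝓞 ℚ)} (hv₀ : (q₀ : 𝓞 ℚ) ∈ v₀.asIdeal)
    {Wd : WeierstrassCurve ℚ} [Wd.IsElliptic] (Cd : VariableChange ℚ) (hCd : Cd • W.quadraticTwist (d : ℚ) = Wd)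
    (hSel : Nat.card (Wd.selmerGroup 2) = 2) :
    ∃ u ∈ W.selmerGroup 2, u ≠ 0 ∧ u ∈ W.torsionLocalKer (v₀.adicCompletion ℚ) 2 := by
  change ∃ u ∈ W.selmerGroup ((2 : ℕ) : ℤ), u ≠ 0 ∧ u ∈ W.torsionLocalKer (v₀.adicCompletion ℚ) ((2 : ℕ) : ℤ)
  have hcard := natCard_doorTrivial_eq_two W hΔ h4 hd hv₀ Cd hCd hSel
  obtain ⟨t, ht, -⟩ := (Nat.card_eq_two_iff' (⟨0, AddSubgroup.zero_mem _, AddSubgroup.zero_mem _⟩ :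
    {s : galH1Torsion W ((2 : ℕ) : ℤ) // s ∈ W.selmerGroup ((2 : ℕ) : ℤ) ∧ s ∈ W.torsionLocalKer (v₀.adicCompletion ℚ) ((2 : ℕ) : ℤ)})).mp hcard
  exact ⟨t.1, t.2.1, fun h ↦ ht (Subtype.ext h), t.2.2⟩

/-- **`ℓ₀`-NARROWNESS IS AUTOMATIC**: on the transposition-admissible frame (`Δ_E < 0`) SOME `2`-Selmer class of `E` is NON-trivial at the door place (the
`v₀`-trivial line has `2 < 4` elements).  BSD is NOT proved by this. [cite: MazurRubin2010, Lemma 2.2, Prop 3.3] [cite: Kramer1981, Prop. 3] -/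
theorem exists_not_doorTrivial (hΔ : W.Δ < 0) (h4 : Nat.card (W.selmerGroup 2) = 4)
    (hd : TranspAdmissible W d q₀) {v₀ : HeightOneSpectrum (𝓞 ℚ)} (hv₀ : (q₀ : 𝓞 ℚ) ∈ v₀.asIdeal)
    {Wd : WeierstrassCurve ℚ} [Wd.IsElliptic] (Cd : VariableChange ℚ) (hCd : Cd • W.quadraticTwist (d : ℚ) = Wd)
    (hSel : Nat.card (Wd.selmerGroup 2) = 2) :
    ∃ c ∈ W.selmerGroup 2, c ∉ W.torsionLocalKer (v₀.adicCompletion ℚ) 2 := by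
  change ∃ c ∈ W.selmerGroup ((2 : ℕ) : ℤ), c ∉ W.torsionLocalKer (v₀.adicCompletion ℚ) ((2 : ℕ) : ℤ)
  by_contra hno
  push Not at hno
  have hcard := natCard_doorTrivial_eq_two W hΔ h4 hd hv₀ Cd hCd hSel
  have h4' : Nat.card (W.selmerGroup ((2 : ℕ) : ℤ)) = 4 := h4
  have e : {s : galH1Torsion W ((2 : ℕ) : ℤ) // s ∈ W.selmerGroup ((2 : ℕ) : ℤ) ∧ s ∈ W.torsionLocalKer (v₀.adicCompletion ℚ) ((2 : ℕ) : ℤ)} ≃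
      W.selmerGroup ((2 : ℕ) : ℤ) :=
    { toFun := fun x ↦ ⟨x.1, x.2.1⟩
      invFun := fun x ↦ ⟨x.1, x.2, hno x.1 x.2⟩
      left_inv := fun x ↦ rfl
      right_inv := fun x ↦ rfl }
  rw [Nat.card_congr e, h4'] at hcard
  omega

end Summit.BirchSwinnertonDyer.BirchSwinnertonDyer.Theorems.GenusExact.PlusDescent.SocleSelection

end
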